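import Literature.Probability.LatticeModels.BoundarySurgeryCoupling
import Literature.Probability.LatticeModels.GlauberCovarianceDecay
import Mathlib.Analysis.SpecificLimits.Basic
import HarnessLib

/-!
# A block heat-bath coupling: from a one-block finite-size condition to exponential decay of a boundary
# perturbation ([MOS94] Thm 1.1 / [MO1] Thm 4.1, coupling rendering) — PROVED, abstract core

Topic `Literature/Probability/LatticeModels`; cell `ym-ir`, seat lit-3 (census row B2 «weak mixing ⇒ strong
mixing in two dimensions»).  THEOREMS ONLY (D-0026).  This is the model-independent core of the tree's proof of
[MOS94] Theorem 1.1 (`MOS1994_weakMixing_imp_strongMixing`, F. Martinelli, E. Olivieri, R. H. Schonmann, *For 2-D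
lattice spin systems weak mixing implies strong mixing*, Commun. Math. Phys. 165 (1994) 33–47): the step «a
finite-size condition on ONE block ⇒ strong mixing on all large volumes», which [MOS94] p0006 L25–34 imports
from [MO1] (F. Martinelli, E. Olivieri, CMP 161 (1994) 447–486, Thm 4.1 / Prop 4.1: block Glauber dynamics,
uniform spectral gap, gap ⇒ strong mixing).  [MO1] is not held (acq-03742); we replace its spectral-gap route by
a PATH-COUPLING analysis of the same block heat-bath dynamics, in discrete time and with randomly placed blocks,
written with the finite coupling calculus of `BoundarySurgeryCoupling.lean`:

* the COUPLED BLOCK CHAIN (`bstep`, `mstep`, `chain`): a pair of `Λ`-configurations (first glued to `τ`,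
  second to `τ′` off `Λ`); at each step a block `B_i ⊆ Λ` is drawn with probability `π_i` and BOTH copies are
  resampled on `B_i` from their conditional laws, coupled by the step kernel `T` of `BoundarySurgeryCoupling`
  (optimal coupling of the marginals on a mark set, independent completion) whose mark set is the FAR SET
  `{x ∈ B_i : d(x, z) > g for every disagreement site z of the two boundary conditions on ∂_r^+B_i}`; the
  marginals stay `μ_Λ^τ`, `μ_Λ^{τ′}` (DLR, `sum_wt_rk`);
* the ONE-BLOCK INPUT (hypothesis `hIN`): on every block, events of the far set have probabilities within
  `ε · #(disagreement sites on ∂_r^+B_i)` under the two conditional laws — for squares this is [MOS94]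
  Proposition 2.1 / (2.1) (`WeakMixingSurgery.MOS1994_eq2_1_scales`);
* the UNION BOUND (`dis_bstep_le`, `dis_mstep_le`): the disagreement probabilities `ρ_t(x)` obey the LINEAR
  recursion `ρ_{t+1}(x) ≤ (1 − π{i : x ∈ B_i}) ρ_t(x) + Σ_i π_i 1{x ∈ B_i} [Σ_{z ∈ ∂_r^+B_i ∩ Λ} ρ_t(z)
  (1{d(x,z) ≤ g} + ε) + 1{y ∈ ∂_r^+B_i}(1{d(x,y) ≤ g} + ε)]`;
* the WEIGHTED CONTRACTION (`phi_mstep_le`): with `Φ_t = Σ_x ρ_t(x) e^{m d(x,y)}` and the covering condition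
  `A · π{i : z ∈ ∂_r^+B_i} + κ ≤ π{i : z ∈ B_i}` for all `z ∈ Λ` (`A = (2g+1)^d e^{mg} + ε V e^{m D}`),
  `Φ_{t+1} ≤ (1 − κ) Φ_t + A π{i : y ∈ ∂_r^+B_i}`, whence (`abs_sub_le_of_blockFamily`)
  `|μ_Λ^τ(E) − μ_Λ^{τ′}(E)| ≤ (A π{i : y ∈ ∂_r^+B_i} / κ) · e^{−m d(Δ, y)}` for every event `E` of the spins
  in `Δ ⊆ Λ` and `τ = τ′` off `y`.
The covering condition is where the geometry of the volume enters (for squares: `WeakMixingStrongMixingSquares`).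

References: [MOS94] §2 [cite: MartinelliOlivieriSchonmann1994, Theorem 1.1 (proof, p0006 L25–34)]; [MO1] Thm 4.1
/ Prop 4.1 as quoted there (block dynamics; not held); the surgery / coupling calculus [cite:
MartinelliOlivieriSchonmann1994, §2 (2.4)–(2.12)].  Deviation from print: coupling contraction in a weighted
`ℓ¹`-norm of disagreement probabilities instead of [MO1]'s spectral gap; same dynamics (block heat bath).
SIBLING-SETTING result (classical finite-range lattice spin systems with finite spin space); nothing here
concerns gauge theories; the Yang–Mills mass gap (Clay) is NOT touched (R4 closes only the conditional
finite-𝕋⁴ rung `BalabanLadder.UV`).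
-/

open MeasureTheory Finset Filter

noncomputable section

namespace Literature.Probability.LatticeModels

namespace BlockCoupling

open BoundarySurgery DisagreementCoupling DisagreementCovariance

universe v

variable {d : ℕ} {S : Type v} [MeasurableSpace S] [MeasurableSingletonClass S] [Fintype S] [Nonempty S]
  [DecidableEq S] {r : ℕ}

open scoped Classical

/-! ### Elementary helpers -/

omit [MeasurableSpace S] [MeasurableSingletonClass S] [Fintype S] [Nonempty S] [DecidableEq S] in
/-- Triangle inequality for the ℓ^∞ distance on `ℤ^d`. [folklore] -/
private theorem supDist_tri (x y z : Site d) : supDist x z ≤ supDist x y + supDist y z := by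
  rw [supDist_le_iff]
  intro i
  have h1 := natAbs_sub_le_supDist x y i
  have h2 := natAbs_sub_le_supDist y z i
  have : x i - z i = (x i - y i) + (y i - z i) := by ring
  rw [this]
  exact (Int.natAbs_add_le _ _).trans (add_le_add h1 h2)

omit [MeasurableSpace S] [MeasurableSingletonClass S] [Fintype S] [Nonempty S] [DecidableEq S] in
/-- The spliced configuration on `Γ`. [folklore] -/
private theorem splice_mem {Λ Γ : Finset (Site d)} (ζ : ↥Λ → S) (ρ : ↥Γ → S) {x : ↥Λ}
    (hx : (x : Site d) ∈ Γ) : splice ζ ρ x = ρ ⟨x, hx⟩ := by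
  simp [splice, hx]

omit [MeasurableSpace S] [MeasurableSingletonClass S] [Fintype S] [Nonempty S] [DecidableEq S] in
/-- The spliced configuration off `Γ`. [folklore] -/
private theorem splice_not_mem {Λ Γ : Finset (Site d)} (ζ : ↥Λ → S) (ρ : ↥Γ → S) {x : ↥Λ}
    (hx : (x : Site d) ∉ Γ) : splice ζ ρ x = ζ x := by
  simp [splice, hx]

omit [MeasurableSpace S] [MeasurableSingletonClass S] [Fintype S] [DecidableEq S] in
/-- Value of the restriction inside `N`. [folklore] -/
private theorem res_apply' {M N : Finset (Site d)} (ρ : ↥N → S) (x : ↥M) (hx : (x : Site d) ∈ N) :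
    res M ρ x = ρ ⟨x, hx⟩ := by
  simp [res, hx]

omit [MeasurableSpace S] [MeasurableSingletonClass S] [Fintype S] [Nonempty S] [DecidableEq S] in
/-- Push-forward form of a kernel step. [folklore] -/
private theorem sum_push {Ω X : Type*} [Fintype Ω] [Fintype X] [DecidableEq Ω] (ν : Ω → ℝ) (K : Ω → X → ℝ)
    (G : Ω → X → Ω) (f : Ω → ℝ) :
    ∑ p', (∑ p, ν p * ∑ x, K p x * (if G p x = p' then 1 else 0)) * f p' =
      ∑ p, ν p * ∑ x, K p x * f (G p x) := by
  have h1 : ∀ p x, (∑ p', (if G p x = p' then (1 : ℝ) else 0) * f p') = f (G p x) := by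
    intro p x
    rw [Finset.sum_eq_single (G p x)]
    · simp
    · intro p' _ hp'; rw [if_neg (Ne.symm hp'), zero_mul]
    · intro h; exact absurd (Finset.mem_univ _) h
  calc ∑ p', (∑ p, ν p * ∑ x, K p x * (if G p x = p' then 1 else 0)) * f p'
      = ∑ p', ∑ p, ∑ x, ν p * (K p x * ((if G p x = p' then 1 else 0) * f p')) := by
        refine Finset.sum_congr rfl fun p' _ => ?_
        rw [Finset.sum_mul]
        refine Finset.sum_congr rfl fun p _ => ?_
        rw [mul_assoc, Finset.sum_mul, Finset.mul_sum]
        refine Finset.sum_congr rfl fun x _ => ?_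
        ring
    _ = ∑ p, ∑ p', ∑ x, ν p * (K p x * ((if G p x = p' then 1 else 0) * f p')) := Finset.sum_comm
    _ = ∑ p, ∑ x, ∑ p', ν p * (K p x * ((if G p x = p' then 1 else 0) * f p')) :=
        Finset.sum_congr rfl fun p _ => Finset.sum_comm
    _ = ∑ p, ν p * ∑ x, K p x * f (G p x) := by
        refine Finset.sum_congr rfl fun p _ => ?_
        rw [Finset.mul_sum]
        refine Finset.sum_congr rfl fun x _ => ?_
        rw [← Finset.mul_sum, ← Finset.mul_sum, h1]

/-! ### The block step with a configuration-dependent mark set -/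

section Step

variable (U : FRPotential d S r) (β : ℝ) {Λ : Finset (Site d)} (τ τ' : Site d → S)

/-- **One block update of the coupled chain**: resample `B` in both copies with the step kernel `T` of
`BoundarySurgeryCoupling` whose mark set `M p` depends on the current pair `p`.
[cite: MartinelliOlivieriSchonmann1994, §2 (2.4)–(2.9)] -/
def bstep (B : Finset (Site d)) (M : (↥Λ → S) × (↥Λ → S) → Finset (Site d))
    (ν : (↥Λ → S) × (↥Λ → S) → ℝ) : (↥Λ → S) × (↥Λ → S) → ℝ :=
  fun p' => ∑ p, ν p * ∑ ρ : (↥B → S) × (↥B → S),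
    T U β τ τ' B (M p) p ρ.1 ρ.2 * (if (splice p.1 ρ.1, splice p.2 ρ.2) = p' then 1 else 0)

omit [MeasurableSingletonClass S] in
/-- Expectations under a block update. [cite: MartinelliOlivieriSchonmann1994, §2 (2.4)] -/
theorem sum_bstep_mul (B : Finset (Site d)) (M : (↥Λ → S) × (↥Λ → S) → Finset (Site d))
    (ν : (↥Λ → S) × (↥Λ → S) → ℝ) (f : (↥Λ → S) × (↥Λ → S) → ℝ) :
    ∑ p', bstep U β τ τ' B M ν p' * f p' =
      ∑ p, ν p * ∑ ρ : (↥B → S) × (↥B → S),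
        T U β τ τ' B (M p) p ρ.1 ρ.2 * f (splice p.1 ρ.1, splice p.2 ρ.2) :=
  sum_push ν (fun p (ρ : (↥B → S) × (↥B → S)) => T U β τ τ' B (M p) p ρ.1 ρ.2)
    (fun p ρ => (splice p.1 ρ.1, splice p.2 ρ.2)) f

omit [MeasurableSingletonClass S] in
/-- A block update preserves non-negativity. [cite: MartinelliOlivieriSchonmann1994, §2 (2.4)] -/
theorem bstep_nonneg (B : Finset (Site d)) (M : (↥Λ → S) × (↥Λ → S) → Finset (Site d))
    {ν : (↥Λ → S) × (↥Λ → S) → ℝ} (hν : ∀ p, 0 ≤ ν p) (p' : (↥Λ → S) × (↥Λ → S)) :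
    0 ≤ bstep U β τ τ' B M ν p' :=
  Finset.sum_nonneg fun p _ => mul_nonneg (hν p) (Finset.sum_nonneg fun ρ _ =>
    mul_nonneg (T_nonneg U β τ τ' _ _ _ _ _) (by split_ifs <;> norm_num))

/-- **A block update preserves the first marginal** (DLR). [cite: MartinelliOlivieriSchonmann1994, §2 (2.5)] -/
theorem bstep_marg_fst {B : Finset (Site d)} (hB : B ⊆ Λ) {M : (↥Λ → S) × (↥Λ → S) → Finset (Site d)}
    (hM : ∀ p, M p ⊆ B) {ν : (↥Λ → S) × (↥Λ → S) → ℝ}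
    (hν : ∀ g : (↥Λ → S) → ℝ, ∑ p, ν p * g p.1 = ∑ ζ, wt (U.spec β) Λ τ ζ * g ζ)
    (g : (↥Λ → S) → ℝ) : ∑ p', bstep U β τ τ' B M ν p' * g p'.1 = ∑ ζ, wt (U.spec β) Λ τ ζ * g ζ := by
  rw [sum_bstep_mul]
  have h1 : ∀ p, ∑ ρ : (↥B → S) × (↥B → S), T U β τ τ' B (M p) p ρ.1 ρ.2 *
      g (splice p.1 ρ.1, splice p.2 ρ.2).1 = ∑ ρ₁, rk U β τ B p.1 ρ₁ * g (splice p.1 ρ₁) := by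
    intro p
    rw [Fintype.sum_prod_type]
    refine Finset.sum_congr rfl fun ρ₁ _ => ?_
    simp only
    rw [← Finset.sum_mul, sum_T_snd U β τ τ' (hM p)]
  simp_rw [h1]
  rw [hν (fun ζ => ∑ ρ₁, rk U β τ B ζ ρ₁ * g (splice ζ ρ₁)), sum_wt_rk U β hB τ g]

/-- **A block update preserves the second marginal** (DLR). [cite: MartinelliOlivieriSchonmann1994, §2 (2.5)] -/
theorem bstep_marg_snd {B : Finset (Site d)} (hB : B ⊆ Λ) {M : (↥Λ → S) × (↥Λ → S) → Finset (Site d)}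
    (hM : ∀ p, M p ⊆ B) {ν : (↥Λ → S) × (↥Λ → S) → ℝ}
    (hν : ∀ g : (↥Λ → S) → ℝ, ∑ p, ν p * g p.2 = ∑ ζ, wt (U.spec β) Λ τ' ζ * g ζ)
    (g : (↥Λ → S) → ℝ) : ∑ p', bstep U β τ τ' B M ν p' * g p'.2 = ∑ ζ, wt (U.spec β) Λ τ' ζ * g ζ := by
  rw [sum_bstep_mul]
  have h1 : ∀ p, ∑ ρ : (↥B → S) × (↥B → S), T U β τ τ' B (M p) p ρ.1 ρ.2 *
      g (splice p.1 ρ.1, splice p.2 ρ.2).2 = ∑ ρ₂, rk U β τ' B p.2 ρ₂ * g (splice p.2 ρ₂) := by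
    intro p
    rw [Fintype.sum_prod_type, Finset.sum_comm]
    refine Finset.sum_congr rfl fun ρ₂ _ => ?_
    simp only
    rw [← Finset.sum_mul, sum_T_fst U β τ τ' (hM p)]
  simp_rw [h1]
  rw [hν (fun ζ => ∑ ρ₂, rk U β τ' B ζ ρ₂ * g (splice ζ ρ₂)), sum_wt_rk U β hB τ' g]

/-! ### The far set and the one-block disagreement bound -/

/-- The disagreement sites of the two boundary conditions of the block `B` for the pair `p`:
`{z ∈ ∂_r^+B : (p₁ τ)(z) ≠ (p₂ τ′)(z)}`. [cite: MartinelliOlivieriSchonmann1994, §2 (2.1)] -/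
def disB (B : Finset (Site d)) (p : (↥Λ → S) × (↥Λ → S)) : Finset (Site d) :=
  (rOuterBoundary r B).filter fun z => glueWith Λ p.1 τ z ≠ glueWith Λ p.2 τ' z

/-- The FAR SET of the block `B` for the pair `p`: the sites of `B` at distance `> g` from every disagreement
site of the two boundary conditions (the mark set of the block update).
[cite: MartinelliOlivieriSchonmann1994, §2 (the set `Q_{L,τ,τ′}`)] -/
def far (g : ℕ) (B : Finset (Site d)) (p : (↥Λ → S) × (↥Λ → S)) : Finset (Site d) :=
  B.filter fun x => ∀ z ∈ disB (r := r) τ τ' B p, g < supDist x z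

omit [MeasurableSpace S] [MeasurableSingletonClass S] [Fintype S] [Nonempty S] in
/-- The far set lies in the block. [folklore] -/
private theorem far_subset (g : ℕ) (B : Finset (Site d)) (p : (↥Λ → S) × (↥Λ → S)) :
    far (r := r) τ τ' g B p ⊆ B :=
  Finset.filter_subset _ _

/-- The disagreement indicator of a pair of `Λ`-configurations at a site (`0` off `Λ`). [folklore] -/
def dind (p : (↥Λ → S) × (↥Λ → S)) (z : Site d) : ℝ :=
  if h : z ∈ Λ then (if p.1 ⟨z, h⟩ = p.2 ⟨z, h⟩ then 0 else 1) else 0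

omit [MeasurableSpace S] [MeasurableSingletonClass S] [Fintype S] [Nonempty S] in
/-- `0 ≤ dind`. [folklore] -/
private theorem dind_nonneg (p : (↥Λ → S) × (↥Λ → S)) (z : Site d) : 0 ≤ dind (Λ := Λ) p z := by
  unfold dind; split_ifs <;> norm_num

omit [MeasurableSpace S] [MeasurableSingletonClass S] [Fintype S] [Nonempty S] in
/-- `dind ≤ 1`. [folklore] -/
private theorem dind_le_one (p : (↥Λ → S) × (↥Λ → S)) (z : Site d) : dind (Λ := Λ) p z ≤ 1 := by
  unfold dind; split_ifs <;> norm_num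

omit [MeasurableSpace S] [MeasurableSingletonClass S] [Fintype S] [Nonempty S] in
/-- `dind p z = 1` iff `z ∈ Λ` and the pair disagrees at `z`. [folklore] -/
private theorem dind_eq_one_of_ne (p : (↥Λ → S) × (↥Λ → S)) {z : Site d} (hz : z ∈ Λ) (hne : p.1 ⟨z, hz⟩ ≠ p.2 ⟨z, hz⟩) :
    dind (Λ := Λ) p z = 1 := by
  unfold dind; rw [dif_pos hz, if_neg hne]

/-- The creation kernel `1{d(x,z) ≤ g} + ε`. [folklore] -/
def crea (g : ℕ) (ε : ℝ) (x z : Site d) : ℝ := (if supDist x z ≤ g then 1 else 0) + ε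

omit [MeasurableSpace S] [MeasurableSingletonClass S] [Fintype S] [Nonempty S] [DecidableEq S] in
/-- `crea ≥ 0` for `ε ≥ 0`. [folklore] -/
private theorem crea_nonneg (g : ℕ) {ε : ℝ} (hε : 0 ≤ ε) (x z : Site d) : 0 ≤ crea (d := d) g ε x z := by
  unfold crea; split_ifs <;> linarith

omit [MeasurableSpace S] [MeasurableSingletonClass S] [Fintype S] [Nonempty S] [DecidableEq S] in
/-- `crea ≥ ε`. [folklore] -/
private theorem le_crea (g : ℕ) (ε : ℝ) (x z : Site d) : ε ≤ crea (d := d) g ε x z := by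
  unfold crea; split_ifs <;> linarith

/-- The per-pair bound produced by one block update at the site `x ∈ Λ`: outside the block the old indicator,
inside the block `Σ_{z ∈ disB} (1{d(x,z) ≤ g} + ε)`. [cite: MartinelliOlivieriSchonmann1994, §2 (2.1)] -/
def bnd (g : ℕ) (ε : ℝ) (B : Finset (Site d)) (p : (↥Λ → S) × (↥Λ → S)) (x : Site d) : ℝ :=
  if x ∈ B then ∑ z ∈ disB (r := r) τ τ' B p, crea g ε x z else dind p x

/-- **The one-block disagreement bound.**  If on the block `B ⊆ Λ` the far-set marginals of the two
conditional laws are within `ε · #disB` in variation for every input pair, then after the block update the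
probability of a disagreement at `x` is at most the `ν`-average of `bnd`: unchanged outside `B`, and inside `B`
at most `Σ_{z ∈ disB}(1{d(x,z) ≤ g} + ε)` (a disagreement in the far set costs the variation distance, a
disagreement within `g` of a disagreement site costs at most one).
[cite: MartinelliOlivieriSchonmann1994, §2 (2.8), (2.1)] -/
theorem dis_bstep_le {B : Finset (Site d)} {g : ℕ} {ε : ℝ} (hε : 0 ≤ ε)
    (hIN : ∀ p : (↥Λ → S) × (↥Λ → S),
      tvd (qM U β τ B (far (r := r) τ τ' g B p) p.1) (qM U β τ' B (far (r := r) τ τ' g B p) p.2) ≤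
        ε * (disB (r := r) τ τ' B p).card)
    {ν : (↥Λ → S) × (↥Λ → S) → ℝ} (hν : ∀ p, 0 ≤ ν p) {x : Site d} (hx : x ∈ Λ) :
    ∑ p', bstep U β τ τ' B (far (r := r) τ τ' g B) ν p' * dind p' x ≤
      ∑ p, ν p * bnd (r := r) τ τ' g ε B p x := by
  rw [sum_bstep_mul]
  refine Finset.sum_le_sum fun p _ => mul_le_mul_of_nonneg_left ?_ (hν p)
  set M := far (r := r) τ τ' g B p with hMdef
  have hM : M ⊆ B := far_subset τ τ' g B p
  have hT1 : ∑ ρ : (↥B → S) × (↥B → S), T U β τ τ' B M p ρ.1 ρ.2 = 1 := by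
    rw [Fintype.sum_prod_type]; exact sum_sum_T U β τ τ' hM p
  have hterm0 : ∀ z, (0 : ℝ) ≤ crea g ε x z := crea_nonneg g hε x
  have hle1 : ∑ ρ : (↥B → S) × (↥B → S), T U β τ τ' B M p ρ.1 ρ.2 * dind (splice p.1 ρ.1, splice p.2 ρ.2) x ≤ 1 :=
    calc ∑ ρ : (↥B → S) × (↥B → S), T U β τ τ' B M p ρ.1 ρ.2 * dind (splice p.1 ρ.1, splice p.2 ρ.2) x
        ≤ ∑ ρ : (↥B → S) × (↥B → S), T U β τ τ' B M p ρ.1 ρ.2 :=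
          Finset.sum_le_sum fun ρ _ => (mul_le_mul_of_nonneg_left (dind_le_one _ _)
            (T_nonneg U β τ τ' B M p ρ.1 ρ.2)).trans_eq (mul_one _)
      _ = 1 := hT1
  by_cases hxB : x ∈ B
  · rw [bnd, if_pos hxB]
    by_cases hxM : x ∈ M
    · -- `x` in the far set: a disagreement at `x` is a disagreement of the `M`-restrictions
      have h1 : ∀ ρ : (↥B → S) × (↥B → S), T U β τ τ' B M p ρ.1 ρ.2 * dind (splice p.1 ρ.1, splice p.2 ρ.2) x ≤
          (if res M ρ.1 = res M ρ.2 then 0 else T U β τ τ' B M p ρ.1 ρ.2) := by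
        intro ρ
        have hT0 := T_nonneg U β τ τ' B M p ρ.1 ρ.2
        by_cases hres : res M ρ.1 = res M ρ.2
        · have hxeq : splice p.1 ρ.1 ⟨x, hx⟩ = splice p.2 ρ.2 ⟨x, hx⟩ := by
            rw [splice_mem p.1 ρ.1 (x := ⟨x, hx⟩) hxB, splice_mem p.2 ρ.2 (x := ⟨x, hx⟩) hxB]
            have := congrFun hres ⟨x, hxM⟩
            rwa [res_apply' ρ.1 ⟨x, hxM⟩ hxB, res_apply' ρ.2 ⟨x, hxM⟩ hxB] at this
          have hd0 : dind (splice p.1 ρ.1, splice p.2 ρ.2) x = 0 := by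
            unfold dind; rw [dif_pos hx, if_pos hxeq]
          rw [if_pos hres, hd0, mul_zero]
        · rw [if_neg hres]
          exact (mul_le_mul_of_nonneg_left (dind_le_one _ _) hT0).trans_eq (mul_one _)
      calc ∑ ρ : (↥B → S) × (↥B → S), T U β τ τ' B M p ρ.1 ρ.2 * dind (splice p.1 ρ.1, splice p.2 ρ.2) x
          ≤ ∑ ρ : (↥B → S) × (↥B → S), (if res M ρ.1 = res M ρ.2 then 0 else T U β τ τ' B M p ρ.1 ρ.2) :=
            Finset.sum_le_sum fun ρ _ => h1 ρ
        _ = ∑ ρ₁, ∑ ρ₂, (if res M ρ₁ = res M ρ₂ then 0 else T U β τ τ' B M p ρ₁ ρ₂) := by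
            rw [Fintype.sum_prod_type]
        _ ≤ tvd (qM U β τ B M p.1) (qM U β τ' B M p.2) := sum_T_offDiag_le U β τ τ' hM p
        _ ≤ ε * (disB (r := r) τ τ' B p).card := hIN p
        _ = ∑ z ∈ disB (r := r) τ τ' B p, ε := by rw [Finset.sum_const, nsmul_eq_mul, mul_comm]
        _ ≤ ∑ z ∈ disB (r := r) τ τ' B p, crea g ε x z := Finset.sum_le_sum fun z _ => le_crea g ε x z
    · -- `x` within `g` of a disagreement site `z`: the term of `z` is at least one
      have hxM' : ¬ ∀ z ∈ disB (r := r) τ τ' B p, g < supDist x z := by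
        intro h; exact hxM (Finset.mem_filter.2 ⟨hxB, h⟩)
      push Not at hxM'
      obtain ⟨z, hz, hzg⟩ := hxM'
      calc ∑ ρ : (↥B → S) × (↥B → S), T U β τ τ' B M p ρ.1 ρ.2 * dind (splice p.1 ρ.1, splice p.2 ρ.2) x
          ≤ 1 := hle1
        _ ≤ crea g ε x z := by unfold crea; rw [if_pos hzg]; linarith
        _ ≤ ∑ z ∈ disB (r := r) τ τ' B p, crea g ε x z := Finset.single_le_sum (fun z _ => hterm0 z) hz
  · -- `x` outside the block: unchanged
    rw [bnd, if_neg hxB]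
    have h1 : ∀ ρ : (↥B → S) × (↥B → S), dind (splice p.1 ρ.1, splice p.2 ρ.2) x = dind p x := by
      intro ρ
      have e1 := splice_not_mem p.1 ρ.1 (x := ⟨x, hx⟩) hxB
      have e2 := splice_not_mem p.2 ρ.2 (x := ⟨x, hx⟩) hxB
      simp only [dind, dif_pos hx, e1, e2]
    simp_rw [h1]
    rw [← Finset.sum_mul, hT1, one_mul]

omit [MeasurableSpace S] [MeasurableSingletonClass S] [Fintype S] [Nonempty S] in
/-- The disagreement sites of the block's boundary conditions lie among the disagreement sites of the pair in
`∂_r^+B ∩ Λ` and (as `τ, τ′` differ only at `y`) the site `y`: for `f ≥ 0`,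
`Σ_{z ∈ disB} f z ≤ Σ_{z ∈ ∂_r^+B} dind p z · f z + 1{y ∈ ∂_r^+B} f y`. [folklore] -/
private theorem sum_disB_le {B : Finset (Site d)} {y : Site d} (hττ' : ∀ z, z ≠ y → τ z = τ' z)
    (p : (↥Λ → S) × (↥Λ → S)) {f : Site d → ℝ} (hf : ∀ z, 0 ≤ f z) :
    ∑ z ∈ disB (r := r) τ τ' B p, f z ≤
      (∑ z ∈ rOuterBoundary r B, dind p z * f z) + (if y ∈ rOuterBoundary r B then f y else 0) := by
  set D := disB (r := r) τ τ' B p with hD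
  rw [← Finset.sum_filter_add_sum_filter_not D (fun z => z ∈ Λ)]
  refine add_le_add ?_ ?_
  · -- inside `Λ`: there `dind = 1`
    have hsub : D.filter (fun z => z ∈ Λ) ⊆ rOuterBoundary r B :=
      (Finset.filter_subset _ _).trans (Finset.filter_subset _ _)
    calc ∑ z ∈ D.filter (fun z => z ∈ Λ), f z = ∑ z ∈ D.filter (fun z => z ∈ Λ), dind p z * f z := by
          refine Finset.sum_congr rfl fun z hz => ?_
          obtain ⟨hzD, hzΛ⟩ := Finset.mem_filter.1 hz
          obtain ⟨hzB, hne⟩ := Finset.mem_filter.1 hzD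
          have hne' : p.1 ⟨z, hzΛ⟩ ≠ p.2 ⟨z, hzΛ⟩ := by
            intro heq; apply hne
            rw [glueWith_apply_mem Λ p.1 τ hzΛ, glueWith_apply_mem Λ p.2 τ' hzΛ]
            exact heq
          rw [dind_eq_one_of_ne p hzΛ hne', one_mul]
      _ ≤ ∑ z ∈ rOuterBoundary r B, dind p z * f z :=
          Finset.sum_le_sum_of_subset_of_nonneg hsub fun z _ _ => mul_nonneg (dind_nonneg _ _) (hf z)
  · -- outside `Λ`: only `y` can be a disagreement site
    have hsub : D.filter (fun z => z ∉ Λ) ⊆ (if y ∈ rOuterBoundary r B then {y} else ∅) := by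
      intro z hz
      obtain ⟨hzD, hzΛ⟩ := Finset.mem_filter.1 hz
      obtain ⟨hzB, hne⟩ := Finset.mem_filter.1 hzD
      have hzy : z = y := by
        by_contra hzy
        apply hne
        rw [glueWith_apply_not_mem Λ p.1 τ hzΛ, glueWith_apply_not_mem Λ p.2 τ' hzΛ]
        exact hττ' z hzy
      subst hzy
      rw [if_pos hzB]
      exact Finset.mem_singleton_self z
    calc ∑ z ∈ D.filter (fun z => z ∉ Λ), f z ≤ ∑ z ∈ (if y ∈ rOuterBoundary r B then {y} else ∅), f z :=
          Finset.sum_le_sum_of_subset_of_nonneg hsub fun z _ _ => hf z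
      _ = (if y ∈ rOuterBoundary r B then f y else 0) := by split_ifs <;> simp

end Step

/-! ### The mixture over a weighted family of blocks and the chain -/

section Chain

variable (U : FRPotential d S r) (β : ℝ) (Λ : Finset (Site d)) (τ τ' : Site d → S)
  {ι : Type*} [Fintype ι] (B : ι → Finset (Site d)) (π : ι → ℝ) (g : ℕ)

/-- **One step of the coupled block chain**: draw the block `B_i` with probability `π_i` and update it with the
far set as mark set. [cite: MartinelliOlivieriSchonmann1994, Theorem 1.1 (proof: block dynamics of [MO1])] -/
def mstep (ν : (↥Λ → S) × (↥Λ → S) → ℝ) : (↥Λ → S) × (↥Λ → S) → ℝ :=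
  fun p' => ∑ i, π i * bstep U β τ τ' (B i) (far (r := r) τ τ' g (B i)) ν p'

/-- **The coupled block chain** started from the product coupling.
[cite: MartinelliOlivieriSchonmann1994, Theorem 1.1 (proof: block dynamics of [MO1])] -/
def chain : ℕ → ((↥Λ → S) × (↥Λ → S) → ℝ)
  | 0 => fun p => wt (U.spec β) Λ τ p.1 * wt (U.spec β) Λ τ' p.2
  | t + 1 => mstep U β Λ τ τ' B π g (chain t)

/-- The disagreement probability at the site `x` under the pair function `ν` (`0` off `Λ`). [folklore] -/
def dis (ν : (↥Λ → S) × (↥Λ → S) → ℝ) (x : Site d) : ℝ := ∑ p, ν p * dind (Λ := Λ) p x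

variable {Λ B π}

omit [MeasurableSpace S] [MeasurableSingletonClass S] [Fintype S] [Nonempty S] [DecidableEq S] [Fintype ι] in
/-- Rearranging a mixture: `Σ_{p'} (Σ_i π_i b_i p') f p' = Σ_i π_i Σ_{p'} b_i p' f p'`. [folklore] -/
private theorem sum_mix {Ω : Type*} [Fintype Ω] {κ : Type*} (s : Finset κ) (w : κ → ℝ) (b : κ → Ω → ℝ)
    (f : Ω → ℝ) : ∑ p', (∑ i ∈ s, w i * b i p') * f p' = ∑ i ∈ s, w i * ∑ p', b i p' * f p' := by
  calc ∑ p', (∑ i ∈ s, w i * b i p') * f p' = ∑ p', ∑ i ∈ s, w i * (b i p' * f p') := by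
        refine Finset.sum_congr rfl fun p' _ => ?_
        rw [Finset.sum_mul]
        refine Finset.sum_congr rfl fun i _ => ?_
        ring
    _ = ∑ i ∈ s, ∑ p', w i * (b i p' * f p') := Finset.sum_comm
    _ = ∑ i ∈ s, w i * ∑ p', b i p' * f p' := by simp_rw [Finset.mul_sum]

omit [MeasurableSingletonClass S] in
/-- The mixture step preserves non-negativity. [folklore] -/
private theorem mstep_nonneg (hπ : ∀ i, 0 ≤ π i) {ν : (↥Λ → S) × (↥Λ → S) → ℝ} (hν : ∀ p, 0 ≤ ν p)
    (p' : (↥Λ → S) × (↥Λ → S)) : 0 ≤ mstep U β Λ τ τ' B π g ν p' :=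
  Finset.sum_nonneg fun i _ => mul_nonneg (hπ i) (bstep_nonneg U β τ τ' _ _ hν p')

/-- The mixture step preserves the first marginal. [cite: MartinelliOlivieriSchonmann1994, §2 (2.5)] -/
theorem mstep_marg_fst (hBΛ : ∀ i, B i ⊆ Λ) (hπ1 : ∑ i, π i = 1) {ν : (↥Λ → S) × (↥Λ → S) → ℝ}
    (hν : ∀ f : (↥Λ → S) → ℝ, ∑ p, ν p * f p.1 = ∑ ζ, wt (U.spec β) Λ τ ζ * f ζ)
    (f : (↥Λ → S) → ℝ) : ∑ p', mstep U β Λ τ τ' B π g ν p' * f p'.1 = ∑ ζ, wt (U.spec β) Λ τ ζ * f ζ := by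
  unfold mstep
  rw [sum_mix Finset.univ π (fun i p' => bstep U β τ τ' (B i) (far (r := r) τ τ' g (B i)) ν p') (fun p' => f p'.1)]
  calc ∑ i, π i * ∑ p', bstep U β τ τ' (B i) (far (r := r) τ τ' g (B i)) ν p' * f p'.1
      = ∑ i, π i * ∑ ζ, wt (U.spec β) Λ τ ζ * f ζ := by
        refine Finset.sum_congr rfl fun i _ => ?_
        rw [bstep_marg_fst U β τ τ' (hBΛ i) (fun p => far_subset τ τ' g (B i) p) hν f]
    _ = ∑ ζ, wt (U.spec β) Λ τ ζ * f ζ := by rw [← Finset.sum_mul, hπ1, one_mul]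

/-- The mixture step preserves the second marginal. [cite: MartinelliOlivieriSchonmann1994, §2 (2.5)] -/
theorem mstep_marg_snd (hBΛ : ∀ i, B i ⊆ Λ) (hπ1 : ∑ i, π i = 1) {ν : (↥Λ → S) × (↥Λ → S) → ℝ}
    (hν : ∀ f : (↥Λ → S) → ℝ, ∑ p, ν p * f p.2 = ∑ ζ, wt (U.spec β) Λ τ' ζ * f ζ)
    (f : (↥Λ → S) → ℝ) : ∑ p', mstep U β Λ τ τ' B π g ν p' * f p'.2 = ∑ ζ, wt (U.spec β) Λ τ' ζ * f ζ := by
  unfold mstep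
  rw [sum_mix Finset.univ π (fun i p' => bstep U β τ τ' (B i) (far (r := r) τ τ' g (B i)) ν p') (fun p' => f p'.2)]
  calc ∑ i, π i * ∑ p', bstep U β τ τ' (B i) (far (r := r) τ τ' g (B i)) ν p' * f p'.2
      = ∑ i, π i * ∑ ζ, wt (U.spec β) Λ τ' ζ * f ζ := by
        refine Finset.sum_congr rfl fun i _ => ?_
        rw [bstep_marg_snd U β τ τ' (hBΛ i) (fun p => far_subset τ τ' g (B i) p) hν f]
    _ = ∑ ζ, wt (U.spec β) Λ τ' ζ * f ζ := by rw [← Finset.sum_mul, hπ1, one_mul]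

omit [MeasurableSingletonClass S] in
/-- The chain is non-negative. [folklore] -/
private theorem chain_nonneg (hπ : ∀ i, 0 ≤ π i) : ∀ (t : ℕ) (p : (↥Λ → S) × (↥Λ → S)), 0 ≤ chain U β Λ τ τ' B π g t p
  | 0, _ => mul_nonneg (wt_nonneg _ _ _ _) (wt_nonneg _ _ _ _)
  | t + 1, p => mstep_nonneg U β τ τ' g hπ (chain_nonneg hπ t) p

/-- The chain has first marginal `μ_Λ^τ`. [cite: MartinelliOlivieriSchonmann1994, §2 (2.5)] -/
theorem chain_marg_fst (hBΛ : ∀ i, B i ⊆ Λ) (hπ1 : ∑ i, π i = 1) :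
    ∀ (t : ℕ) (f : (↥Λ → S) → ℝ), ∑ p, chain U β Λ τ τ' B π g t p * f p.1 = ∑ ζ, wt (U.spec β) Λ τ ζ * f ζ
  | 0, f => by
    simp only [chain]
    rw [Fintype.sum_prod_type]
    refine Finset.sum_congr rfl fun ζ _ => ?_
    simp only
    rw [← Finset.sum_mul, ← Finset.mul_sum, sum_wt (U.isSpecification_spec β) Λ τ', mul_one]
  | t + 1, f => by
    simp only [chain]
    exact mstep_marg_fst U β τ τ' g hBΛ hπ1 (chain_marg_fst hBΛ hπ1 t) f

/-- The chain has second marginal `μ_Λ^{τ′}`. [cite: MartinelliOlivieriSchonmann1994, §2 (2.5)] -/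
theorem chain_marg_snd (hBΛ : ∀ i, B i ⊆ Λ) (hπ1 : ∑ i, π i = 1) :
    ∀ (t : ℕ) (f : (↥Λ → S) → ℝ), ∑ p, chain U β Λ τ τ' B π g t p * f p.2 = ∑ ζ, wt (U.spec β) Λ τ' ζ * f ζ
  | 0, f => by
    simp only [chain]
    rw [Fintype.sum_prod_type, Finset.sum_comm]
    refine Finset.sum_congr rfl fun ζ _ => ?_
    simp only
    rw [← Finset.sum_mul, ← Finset.sum_mul, sum_wt (U.isSpecification_spec β) Λ τ, one_mul]
  | t + 1, f => by
    simp only [chain]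
    exact mstep_marg_snd U β τ τ' g hBΛ hπ1 (chain_marg_snd hBΛ hπ1 t) f

/-- The chain has total mass one. [folklore] -/
private theorem sum_chain (hBΛ : ∀ i, B i ⊆ Λ) (hπ1 : ∑ i, π i = 1) (t : ℕ) : ∑ p, chain U β Λ τ τ' B π g t p = 1 := by
  have h := chain_marg_fst U β τ τ' g hBΛ hπ1 t (fun _ => 1)
  simp only [mul_one] at h
  rw [h, sum_wt (U.isSpecification_spec β) Λ τ]

/-! ### The linear recursion for the disagreement probabilities -/

/-- The coverage probability of a site under the block family. [folklore] -/
def covP (z : Site d) : ℝ := ∑ i, π i * (if z ∈ B i then 1 else 0)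

/-- The probability that `z` lies on the outer `r`-boundary of the drawn block. [folklore] -/
def bdP (z : Site d) : ℝ := ∑ i, π i * (if z ∈ rOuterBoundary r (B i) then 1 else 0)

/-- The source term of block `Bi` at `x`: creation from the disagreements on `∂_r^+Bi` and from `y`.
[folklore] -/
def src (ε : ℝ) (y : Site d) (Bi : Finset (Site d)) (ν : (↥Λ → S) × (↥Λ → S) → ℝ) (x : Site d) : ℝ :=
  (∑ z ∈ rOuterBoundary r Bi, dis Λ ν z * crea g ε x z) + (if y ∈ rOuterBoundary r Bi then crea g ε x y else 0)

/-- **The linear recursion** (union bound): after one step of the coupled block chain, for `x ∈ Λ`,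
`ρ′(x) ≤ (1 − covP x) ρ(x) + Σ_i π_i 1{x ∈ B_i} src_i(x)` with
`src_i(x) = Σ_{z ∈ ∂_r^+B_i} ρ(z)(1{d(x,z) ≤ g} + ε) + 1{y ∈ ∂_r^+B_i}(1{d(x,y) ≤ g} + ε)`.
[cite: MartinelliOlivieriSchonmann1994, Theorem 1.1 (proof)] -/
theorem dis_mstep_le {y : Site d} (hττ' : ∀ z, z ≠ y → τ z = τ' z)
    (hπ : ∀ i, 0 ≤ π i) (hπ1 : ∑ i, π i = 1) {ε : ℝ} (hε : 0 ≤ ε)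
    (hIN : ∀ i (p : (↥Λ → S) × (↥Λ → S)),
      tvd (qM U β τ (B i) (far (r := r) τ τ' g (B i) p) p.1) (qM U β τ' (B i) (far (r := r) τ τ' g (B i) p) p.2) ≤
        ε * (disB (r := r) τ τ' (B i) p).card)
    {ν : (↥Λ → S) × (↥Λ → S) → ℝ} (hν : ∀ p, 0 ≤ ν p) (hν1 : ∑ p, ν p = 1) {x : Site d} (hx : x ∈ Λ) :
    dis Λ (mstep U β Λ τ τ' B π g ν) x ≤
      (1 - covP (B := B) (π := π) x) * dis Λ ν x +
        ∑ i, π i * (if x ∈ B i then src (r := r) g ε y (B i) ν x else 0) := by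
  have hf0 : ∀ z : Site d, (0 : ℝ) ≤ crea g ε x z := crea_nonneg g hε x
  -- unfold the mixture
  have h1 : dis Λ (mstep U β Λ τ τ' B π g ν) x =
      ∑ i, π i * ∑ p', bstep U β τ τ' (B i) (far (r := r) τ τ' g (B i)) ν p' * dind p' x := by
    unfold dis mstep
    exact sum_mix Finset.univ π (fun i p' => bstep U β τ τ' (B i) (far (r := r) τ τ' g (B i)) ν p')
      (fun p' => dind p' x)
  rw [h1]
  -- blockwise bound
  have h2 : ∀ i, ∑ p', bstep U β τ τ' (B i) (far (r := r) τ τ' g (B i)) ν p' * dind p' x ≤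
      ∑ p, ν p * bnd (r := r) τ τ' g ε (B i) p x :=
    fun i => dis_bstep_le U β τ τ' hε (hIN i) hν hx
  -- linearised `bnd`, averaged against `ν`
  have h4 : ∀ i, ∑ p, ν p * bnd (r := r) τ τ' g ε (B i) p x ≤
      (if x ∈ B i then 0 else dis Λ ν x) + (if x ∈ B i then src (r := r) g ε y (B i) ν x else 0) := by
    intro i
    by_cases hxB : x ∈ B i
    · simp only [if_pos hxB, zero_add]
      calc ∑ p, ν p * bnd (r := r) τ τ' g ε (B i) p x
          ≤ ∑ p, ν p * ((∑ z ∈ rOuterBoundary r (B i), dind p z * crea g ε x z) +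
              (if y ∈ rOuterBoundary r (B i) then crea g ε x y else 0)) := by
            refine Finset.sum_le_sum fun p _ => mul_le_mul_of_nonneg_left ?_ (hν p)
            unfold bnd; rw [if_pos hxB]
            exact sum_disB_le τ τ' hττ' p hf0
        _ = src (r := r) g ε y (B i) ν x := by
            unfold src dis
            simp_rw [mul_add, Finset.sum_add_distrib, ← Finset.sum_mul, hν1, one_mul]
            congr 1
            simp_rw [Finset.mul_sum]
            rw [Finset.sum_comm]
            refine Finset.sum_congr rfl fun z _ => ?_
            rw [Finset.sum_mul]
            refine Finset.sum_congr rfl fun p _ => ?_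
            ring
    · simp only [if_neg hxB, add_zero]
      unfold dis
      refine Finset.sum_le_sum fun p _ => mul_le_mul_of_nonneg_left ?_ (hν p)
      unfold bnd; rw [if_neg hxB]
  -- assemble
  calc ∑ i, π i * ∑ p', bstep U β τ τ' (B i) (far (r := r) τ τ' g (B i)) ν p' * dind p' x
      ≤ ∑ i, π i * ((if x ∈ B i then 0 else dis Λ ν x) +
          (if x ∈ B i then src (r := r) g ε y (B i) ν x else 0)) :=
        Finset.sum_le_sum fun i _ => mul_le_mul_of_nonneg_left ((h2 i).trans (h4 i)) (hπ i)
    _ = ∑ i, (π i * dis Λ ν x - π i * (if x ∈ B i then 1 else 0) * dis Λ ν x) +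
          ∑ i, π i * (if x ∈ B i then src (r := r) g ε y (B i) ν x else 0) := by
        rw [← Finset.sum_add_distrib]
        refine Finset.sum_congr rfl fun i _ => ?_
        split_ifs <;> ring
    _ = (1 - covP (B := B) (π := π) x) * dis Λ ν x +
          ∑ i, π i * (if x ∈ B i then src (r := r) g ε y (B i) ν x else 0) := by
        rw [Finset.sum_sub_distrib, ← Finset.sum_mul, ← Finset.sum_mul, hπ1]
        unfold covP
        ring

/-! ### The weighted contraction -/

/-- The weight `e^{m d(x,y)}` of the site `x`. [folklore] -/
def wgt (m : ℝ) (y x : Site d) : ℝ := Real.exp (m * supDist x y)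

/-- **The potential** `Φ(ν) = Σ_{x ∈ Λ} ρ(x) e^{m d(x,y)}`. [cite: MartinelliOlivieriSchonmann1994, Theorem 1.1 (proof)] -/
def phi (m : ℝ) (y : Site d) (ν : (↥Λ → S) × (↥Λ → S) → ℝ) : ℝ := ∑ x ∈ Λ, dis Λ ν x * wgt m y x

/-- The creation constant `A = (2g+1)^d e^{mg} + ε V e^{m D}`. [folklore] -/
def Acst (d g : ℕ) (m ε : ℝ) (V Dm : ℕ) : ℝ := (2 * g + 1) ^ d * Real.exp (m * g) + ε * V * Real.exp (m * Dm)

omit [MeasurableSpace S] [MeasurableSingletonClass S] [Fintype S] [Nonempty S] [DecidableEq S] [Fintype ι] in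
/-- `wgt > 0`. [folklore] -/
private theorem wgt_pos (m : ℝ) (y x : Site d) : 0 < wgt (d := d) m y x := Real.exp_pos _

omit [MeasurableSpace S] [MeasurableSingletonClass S] [Fintype S] [Nonempty S] [DecidableEq S] [Fintype ι] in
/-- `wgt m y y = 1`. [folklore] -/
private theorem wgt_self (m : ℝ) (y : Site d) : wgt (d := d) m y y = 1 := by
  simp [wgt]

omit [MeasurableSpace S] [MeasurableSingletonClass S] [Fintype S] [Nonempty S] [DecidableEq S] [Fintype ι] in
/-- `e^{m d(x,y)} ≤ e^{m d(z,y)} e^{m d(x,z)}` for `m ≥ 0`. [folklore] -/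
private theorem wgt_le_mul {m : ℝ} (hm : 0 ≤ m) (y x z : Site d) :
    wgt (d := d) m y x ≤ wgt m y z * Real.exp (m * supDist x z) := by
  unfold wgt
  rw [← Real.exp_add, Real.exp_le_exp]
  have h : (supDist x y : ℝ) ≤ supDist x z + supDist z y := by exact_mod_cast supDist_tri x z y
  nlinarith

omit [MeasurableSpace S] [MeasurableSingletonClass S] [Nonempty S] in
/-- `dis ≥ 0`. [folklore] -/
private theorem dis_nonneg {ν : (↥Λ → S) × (↥Λ → S) → ℝ} (hν : ∀ p, 0 ≤ ν p) (x : Site d) : 0 ≤ dis Λ ν x :=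
  Finset.sum_nonneg fun p _ => mul_nonneg (hν p) (dind_nonneg p x)

omit [MeasurableSpace S] [MeasurableSingletonClass S] [Nonempty S] in
/-- `dis ≤ 1` for a pair function of total mass one. [folklore] -/
private theorem dis_le_one {ν : (↥Λ → S) × (↥Λ → S) → ℝ} (hν : ∀ p, 0 ≤ ν p) (hν1 : ∑ p, ν p = 1) (x : Site d) :
    dis Λ ν x ≤ 1 :=
  calc dis Λ ν x ≤ ∑ p, ν p * 1 := Finset.sum_le_sum fun p _ => mul_le_mul_of_nonneg_left (dind_le_one p x) (hν p)
    _ = 1 := by rw [← Finset.sum_mul, hν1, one_mul]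

omit [MeasurableSpace S] [MeasurableSingletonClass S] [Nonempty S] in
/-- `dis` vanishes off `Λ`. [folklore] -/
private theorem dis_eq_zero_of_not_mem (ν : (↥Λ → S) × (↥Λ → S) → ℝ) {x : Site d} (hx : x ∉ Λ) : dis Λ ν x = 0 := by
  unfold dis dind
  simp [hx]

omit [MeasurableSpace S] [MeasurableSingletonClass S] [Fintype S] [Nonempty S] [DecidableEq S] [Fintype ι] in
/-- **The creation bound for one block**: for `z` within `D` of every site of `Bi` (`|Bi| ≤ V`, `m, ε ≥ 0`),
`Σ_{x ∈ Bi} e^{m d(x,y)} (1{d(x,z) ≤ g} + ε) ≤ A e^{m d(z,y)}`. [folklore] -/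
private theorem sum_wgt_crea_le {m ε : ℝ} (hm : 0 ≤ m) (hε : 0 ≤ ε) {V Dm : ℕ} {Bi : Finset (Site d)}
    (hV : Bi.card ≤ V) {z : Site d} (hz : ∀ x ∈ Bi, supDist x z ≤ Dm) (y : Site d) :
    ∑ x ∈ Bi, wgt m y x * crea g ε x z ≤ Acst d g m ε V Dm * wgt m y z := by
  have hw0 := (wgt_pos (d := d) m y z).le
  -- termwise: indicator part and `ε` part
  have hterm : ∀ x ∈ Bi, wgt m y x * crea g ε x z ≤
      (if x ∈ rNeighbourhood g z then wgt m y z * Real.exp (m * g) else 0) + ε * (wgt m y z * Real.exp (m * Dm)) := by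
    intro x hx
    have h1 := wgt_le_mul hm y x z
    have hxz : (supDist x z : ℝ) ≤ Dm := by exact_mod_cast hz x hx
    have h2 : wgt m y x ≤ wgt m y z * Real.exp (m * Dm) :=
      h1.trans (mul_le_mul_of_nonneg_left (Real.exp_le_exp.2 (mul_le_mul_of_nonneg_left hxz hm)) hw0)
    unfold crea
    by_cases hg : supDist x z ≤ g
    · have hxg : (supDist x z : ℝ) ≤ g := by exact_mod_cast hg
      have h3 : wgt m y x ≤ wgt m y z * Real.exp (m * g) :=
        h1.trans (mul_le_mul_of_nonneg_left (Real.exp_le_exp.2 (mul_le_mul_of_nonneg_left hxg hm)) hw0)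
      rw [if_pos hg, if_pos (mem_rNeighbourhood.2 hg), mul_add, mul_one, mul_comm (wgt m y x) ε]
      exact add_le_add h3 (mul_le_mul_of_nonneg_left h2 hε)
    · rw [if_neg hg, zero_add, mul_comm (wgt m y x) ε]
      have : (0 : ℝ) ≤ (if x ∈ rNeighbourhood g z then wgt m y z * Real.exp (m * g) else 0) := by
        split_ifs
        · positivity
        · exact le_rfl
      linarith [mul_le_mul_of_nonneg_left h2 hε]
  refine (Finset.sum_le_sum hterm).trans ?_
  rw [Finset.sum_add_distrib, Finset.sum_const, nsmul_eq_mul, ← Finset.sum_filter]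
  rw [Finset.sum_const, nsmul_eq_mul]
  -- counting
  have hc1 : ((Bi.filter fun x => x ∈ rNeighbourhood g z).card : ℝ) ≤ (2 * g + 1) ^ d := by
    have hsub : (Bi.filter fun x => x ∈ rNeighbourhood g z) ⊆ rNeighbourhood g z :=
      fun x hx => (Finset.mem_filter.1 hx).2
    have h := Finset.card_le_card hsub
    rw [card_rNeighbourhood] at h
    exact_mod_cast h
  have hc2 : (Bi.card : ℝ) ≤ V := by exact_mod_cast hV
  unfold Acst
  have e1 : 0 ≤ wgt m y z * Real.exp (m * g) := by positivity
  have e2 : 0 ≤ ε * (wgt m y z * Real.exp (m * Dm)) := by positivity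
  calc ((Bi.filter fun x => x ∈ rNeighbourhood g z).card : ℝ) * (wgt m y z * Real.exp (m * g)) +
        (Bi.card : ℝ) * (ε * (wgt m y z * Real.exp (m * Dm)))
      ≤ (2 * g + 1) ^ d * (wgt m y z * Real.exp (m * g)) + V * (ε * (wgt m y z * Real.exp (m * Dm))) :=
        add_le_add (mul_le_mul_of_nonneg_right hc1 e1) (mul_le_mul_of_nonneg_right hc2 e2)
    _ = ((2 * g + 1) ^ d * Real.exp (m * g) + ε * V * Real.exp (m * Dm)) * wgt m y z := by ring

omit [MeasurableSpace S] [MeasurableSingletonClass S] [Nonempty S] in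
/-- A sum of `dis`-weighted terms over any finite set equals the sum over its part in `Λ`. [folklore] -/
private theorem sum_dis_mul_eq_sum_filter (ν : (↥Λ → S) × (↥Λ → S) → ℝ) (A : Finset (Site d)) (f : Site d → ℝ) :
    ∑ z ∈ A, dis Λ ν z * f z = ∑ z ∈ Λ, (if z ∈ A then dis Λ ν z * f z else 0) := by
  rw [← Finset.sum_filter]
  have h1 : ∑ z ∈ A, dis Λ ν z * f z = ∑ z ∈ A.filter (fun z => z ∈ Λ), dis Λ ν z * f z := by
    rw [Finset.sum_filter]
    refine Finset.sum_congr rfl fun z _ => ?_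
    split_ifs with h
    · rfl
    · rw [dis_eq_zero_of_not_mem ν h, zero_mul]
  rw [h1]
  refine Finset.sum_congr ?_ fun _ _ => rfl
  ext z
  simp only [Finset.mem_filter]
  tauto

/-- **The weighted contraction** ([MOS94] Thm 1.1 via a coupling analysis of [MO1]'s block dynamics): under the
one-block input, the covering condition `A · bdP z + κ ≤ covP z` on `Λ` and the block-diameter / volume bounds,
`Φ(ν′) ≤ (1 − κ) Φ(ν) + A · bdP y` after one step of the coupled block chain.
[cite: MartinelliOlivieriSchonmann1994, Theorem 1.1 (proof)] -/
theorem phi_mstep_le {y : Site d} (hττ' : ∀ z, z ≠ y → τ z = τ' z) (hBΛ : ∀ i, B i ⊆ Λ)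
    (hπ : ∀ i, 0 ≤ π i) (hπ1 : ∑ i, π i = 1) {ε : ℝ} (hε : 0 ≤ ε)
    (hIN : ∀ i (p : (↥Λ → S) × (↥Λ → S)),
      tvd (qM U β τ (B i) (far (r := r) τ τ' g (B i) p) p.1) (qM U β τ' (B i) (far (r := r) τ τ' g (B i) p) p.2) ≤
        ε * (disB (r := r) τ τ' (B i) p).card)
    {m : ℝ} (hm : 0 ≤ m) {V Dm : ℕ} (hV : ∀ i, (B i).card ≤ V)
    (hDm : ∀ i, ∀ z ∈ rOuterBoundary r (B i), ∀ x ∈ B i, supDist x z ≤ Dm)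
    {κ : ℝ} (hG2 : ∀ z ∈ Λ, Acst d g m ε V Dm * bdP (r := r) (B := B) (π := π) z + κ ≤ covP (B := B) (π := π) z)
    {ν : (↥Λ → S) × (↥Λ → S) → ℝ} (hν : ∀ p, 0 ≤ ν p) (hν1 : ∑ p, ν p = 1) :
    phi (Λ := Λ) m y (mstep U β Λ τ τ' B π g ν) ≤ (1 - κ) * phi (Λ := Λ) m y ν + Acst d g m ε V Dm * bdP (r := r) (B := B) (π := π) y := by
  set A := Acst d g m ε V Dm with hA
  have hA0 : 0 ≤ A := by rw [hA]; unfold Acst; positivity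
  have hw0 : ∀ x, 0 ≤ wgt (d := d) m y x := fun x => (wgt_pos m y x).le
  have hdis0 : ∀ x, 0 ≤ dis Λ ν x := dis_nonneg hν
  -- step 1: the linear recursion, weighted and summed
  have h1 : phi (Λ := Λ) m y (mstep U β Λ τ τ' B π g ν) ≤
      ∑ x ∈ Λ, ((1 - covP (B := B) (π := π) x) * dis Λ ν x +
        ∑ i, π i * (if x ∈ B i then src (r := r) g ε y (B i) ν x else 0)) * wgt m y x := by
    unfold phi
    exact Finset.sum_le_sum fun x hx =>
      mul_le_mul_of_nonneg_right (dis_mstep_le U β τ τ' g hττ' hπ hπ1 hε hIN hν hν1 hx) (hw0 x)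
  refine h1.trans ?_
  rw [Finset.sum_congr rfl fun x _ => add_mul _ _ (wgt m y x), Finset.sum_add_distrib]
  -- step 2: the creation part of one block
  have h2 : ∀ i, ∑ x ∈ Λ, (π i * (if x ∈ B i then src (r := r) g ε y (B i) ν x else 0)) * wgt m y x ≤
      π i * (A * ∑ z ∈ rOuterBoundary r (B i), dis Λ ν z * wgt m y z +
        A * (if y ∈ rOuterBoundary r (B i) then 1 else 0)) := by
    intro i
    -- restrict the sum to `B i ⊆ Λ`
    have e1 : ∑ x ∈ Λ, (π i * (if x ∈ B i then src (r := r) g ε y (B i) ν x else 0)) * wgt m y x =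
        π i * ∑ x ∈ B i, src (r := r) g ε y (B i) ν x * wgt m y x := by
      rw [Finset.mul_sum]
      have : ∑ x ∈ B i, π i * (src (r := r) g ε y (B i) ν x * wgt m y x) =
          ∑ x ∈ Λ, (if x ∈ B i then π i * (src (r := r) g ε y (B i) ν x * wgt m y x) else 0) := by
        rw [← Finset.sum_filter]
        refine Finset.sum_congr ?_ fun _ _ => rfl
        ext x; simp only [Finset.mem_filter]
        exact ⟨fun h => ⟨hBΛ i h, h⟩, fun h => h.2⟩
      rw [this]
      refine Finset.sum_congr rfl fun x _ => ?_
      split_ifs <;> ring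
    rw [e1]
    refine mul_le_mul_of_nonneg_left ?_ (hπ i)
    -- expand `src` and exchange sums
    have e2 : ∑ x ∈ B i, src (r := r) g ε y (B i) ν x * wgt m y x =
        ∑ z ∈ rOuterBoundary r (B i), dis Λ ν z * ∑ x ∈ B i, wgt m y x * crea g ε x z +
          (if y ∈ rOuterBoundary r (B i) then ∑ x ∈ B i, wgt m y x * crea g ε x y else 0) := by
      unfold src
      simp_rw [add_mul, Finset.sum_add_distrib, Finset.sum_mul]
      congr 1
      · rw [Finset.sum_comm]
        refine Finset.sum_congr rfl fun z _ => ?_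
        rw [Finset.mul_sum]
        refine Finset.sum_congr rfl fun x _ => ?_
        ring
      · split_ifs
        · refine Finset.sum_congr rfl fun x _ => ?_; ring
        · simp
    rw [e2]
    refine add_le_add ?_ ?_
    · rw [Finset.mul_sum]
      refine Finset.sum_le_sum fun z hz => ?_
      calc dis Λ ν z * ∑ x ∈ B i, wgt m y x * crea g ε x z ≤ dis Λ ν z * (A * wgt m y z) :=
            mul_le_mul_of_nonneg_left (sum_wgt_crea_le g hm hε (hV i) (fun x hx => hDm i z hz x hx) y) (hdis0 z)
        _ = A * (dis Λ ν z * wgt m y z) := by ring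
    · split_ifs with hy
      · have := sum_wgt_crea_le g hm hε (hV i) (fun x hx => hDm i y hy x hx) y
        rw [wgt_self, mul_one] at this
        rw [mul_one]; exact this
      · rw [mul_zero]
  -- step 3: sum over the blocks
  have h3 : ∑ x ∈ Λ, (∑ i, π i * (if x ∈ B i then src (r := r) g ε y (B i) ν x else 0)) * wgt m y x ≤
      A * ∑ z ∈ Λ, dis Λ ν z * wgt m y z * bdP (r := r) (B := B) (π := π) z + A * bdP (r := r) (B := B) (π := π) y := by
    calc ∑ x ∈ Λ, (∑ i, π i * (if x ∈ B i then src (r := r) g ε y (B i) ν x else 0)) * wgt m y x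
        = ∑ i, ∑ x ∈ Λ, (π i * (if x ∈ B i then src (r := r) g ε y (B i) ν x else 0)) * wgt m y x := by
          rw [Finset.sum_comm]
          refine Finset.sum_congr rfl fun x _ => ?_
          rw [Finset.sum_mul]
      _ ≤ ∑ i, π i * (A * ∑ z ∈ rOuterBoundary r (B i), dis Λ ν z * wgt m y z +
            A * (if y ∈ rOuterBoundary r (B i) then 1 else 0)) := Finset.sum_le_sum fun i _ => h2 i
      _ = A * ∑ i, π i * ∑ z ∈ rOuterBoundary r (B i), dis Λ ν z * wgt m y z +
            A * bdP (r := r) (B := B) (π := π) y := by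
          unfold bdP
          rw [Finset.mul_sum, Finset.mul_sum, ← Finset.sum_add_distrib]
          refine Finset.sum_congr rfl fun i _ => ?_
          ring
      _ = A * ∑ z ∈ Λ, dis Λ ν z * wgt m y z * bdP (r := r) (B := B) (π := π) z +
            A * bdP (r := r) (B := B) (π := π) y := by
          congr 2
          unfold bdP
          simp_rw [sum_dis_mul_eq_sum_filter ν (rOuterBoundary r (B _)) (wgt m y)]
          simp_rw [Finset.mul_sum]
          rw [Finset.sum_comm]
          refine Finset.sum_congr rfl fun z _ => Finset.sum_congr rfl fun i _ => ?_
          split_ifs <;> ring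
  -- step 4: the covering condition
  have h4 : ∑ x ∈ Λ, (1 - covP (B := B) (π := π) x) * dis Λ ν x * wgt m y x +
      A * ∑ z ∈ Λ, dis Λ ν z * wgt m y z * bdP (r := r) (B := B) (π := π) z ≤ (1 - κ) * phi (Λ := Λ) m y ν := by
    unfold phi
    rw [Finset.mul_sum, Finset.mul_sum, ← Finset.sum_add_distrib]
    refine Finset.sum_le_sum fun z hz => ?_
    have hg := hG2 z hz
    have h0 : 0 ≤ dis Λ ν z * wgt m y z := mul_nonneg (hdis0 z) (hw0 z)
    nlinarith
  linarith [h3, h4]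

/-- **Iterating the contraction**: `Φ(ν_t) ≤ (1 − κ)^t Φ(ν_0) + A bdP(y)/κ` for `0 < κ ≤ 1`.
[cite: MartinelliOlivieriSchonmann1994, Theorem 1.1 (proof)] -/
theorem phi_chain_le {y : Site d} (hττ' : ∀ z, z ≠ y → τ z = τ' z) (hBΛ : ∀ i, B i ⊆ Λ)
    (hπ : ∀ i, 0 ≤ π i) (hπ1 : ∑ i, π i = 1) {ε : ℝ} (hε : 0 ≤ ε)
    (hIN : ∀ i (p : (↥Λ → S) × (↥Λ → S)),
      tvd (qM U β τ (B i) (far (r := r) τ τ' g (B i) p) p.1) (qM U β τ' (B i) (far (r := r) τ τ' g (B i) p) p.2) ≤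
        ε * (disB (r := r) τ τ' (B i) p).card)
    {m : ℝ} (hm : 0 ≤ m) {V Dm : ℕ} (hV : ∀ i, (B i).card ≤ V)
    (hDm : ∀ i, ∀ z ∈ rOuterBoundary r (B i), ∀ x ∈ B i, supDist x z ≤ Dm)
    {κ : ℝ} (hκ0 : 0 < κ) (hκ1 : κ ≤ 1)
    (hG2 : ∀ z ∈ Λ, Acst d g m ε V Dm * bdP (r := r) (B := B) (π := π) z + κ ≤ covP (B := B) (π := π) z) (t : ℕ) :
    phi (Λ := Λ) m y (chain U β Λ τ τ' B π g t) ≤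
      (1 - κ) ^ t * phi (Λ := Λ) m y (chain U β Λ τ τ' B π g 0) + Acst d g m ε V Dm * bdP (r := r) (B := B) (π := π) y / κ := by
  set A := Acst d g m ε V Dm with hA
  set b := A * bdP (r := r) (B := B) (π := π) y with hb
  have hb0 : 0 ≤ b := by
    rw [hb, hA]; unfold Acst bdP
    exact mul_nonneg (by positivity) (Finset.sum_nonneg fun i _ => mul_nonneg (hπ i) (by split_ifs <;> norm_num))
  induction t with
  | zero =>
    rw [pow_zero, one_mul]
    have : 0 ≤ b / κ := div_nonneg hb0 hκ0.le
    linarith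
  | succ t ih =>
    have hstep := phi_mstep_le U β τ τ' g hττ' hBΛ hπ hπ1 hε hIN hm hV hDm hG2
      (chain_nonneg U β τ τ' g hπ t) (sum_chain U β τ τ' g hBΛ hπ1 t) (y := y)
    simp only [chain]
    have h1κ : 0 ≤ 1 - κ := by linarith
    calc phi (Λ := Λ) m y (mstep U β Λ τ τ' B π g (chain U β Λ τ τ' B π g t))
        ≤ (1 - κ) * phi (Λ := Λ) m y (chain U β Λ τ τ' B π g t) + b := hstep
      _ ≤ (1 - κ) * ((1 - κ) ^ t * phi (Λ := Λ) m y (chain U β Λ τ τ' B π g 0) + b / κ) + b := by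
          have hmul := mul_le_mul_of_nonneg_left ih h1κ
          linarith
      _ = (1 - κ) ^ (t + 1) * phi (Λ := Λ) m y (chain U β Λ τ τ' B π g 0) + b / κ := by
          field_simp
          ring

/-! ### From the potential to probabilities -/

/-- The difference of the two finite-volume probabilities of a `Δ`-local event is at most the total
disagreement probability on `Δ` under any coupling (here: the chain at time `t`).
[cite: MartinelliOlivieriSchonmann1994, §1 (1.8)] -/
theorem abs_sub_le_sum_dis (hBΛ : ∀ i, B i ⊆ Λ) (hπ : ∀ i, 0 ≤ π i) (hπ1 : ∑ i, π i = 1) (t : ℕ)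
    {Δ : Finset (Site d)} (hΔ : Δ ⊆ Λ) {E : Set (Site d → S)} (hE : MeasurableSet E)
    (hdep : DependsOn (· ∈ E) (↑Δ : Set (Site d))) :
    |(U.spec β Λ τ).real E - (U.spec β Λ τ').real E| ≤ ∑ x ∈ Δ, dis Λ (chain U β Λ τ τ' B π g t) x := by
  have hγ := U.isSpecification_spec β
  haveI := hγ.isProbability Λ τ
  haveI := hγ.isProbability Λ τ'
  set ν := chain U β Λ τ τ' B π g t with hν
  have hν0 : ∀ p, 0 ≤ ν p := chain_nonneg U β τ τ' g hπ t
  have h1 : (U.spec β Λ τ).real E = ∑ p, ν p * (if glueWith Λ p.1 τ ∈ E then 1 else 0) := by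
    rw [real_eq_sum_fiber Λ (U.spec β Λ τ) (hγ.proper Λ τ) hE]
    exact (chain_marg_fst U β τ τ' g hBΛ hπ1 t (fun ζ => if glueWith Λ ζ τ ∈ E then 1 else 0)).symm
  have h2 : (U.spec β Λ τ').real E = ∑ p, ν p * (if glueWith Λ p.2 τ' ∈ E then 1 else 0) := by
    rw [real_eq_sum_fiber Λ (U.spec β Λ τ') (hγ.proper Λ τ') hE]
    exact (chain_marg_snd U β τ τ' g hBΛ hπ1 t (fun ζ => if glueWith Λ ζ τ' ∈ E then 1 else 0)).symm
  rw [h1, h2, ← Finset.sum_sub_distrib]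
  have h3 : ∀ p, |ν p * (if glueWith Λ p.1 τ ∈ E then 1 else 0) - ν p * (if glueWith Λ p.2 τ' ∈ E then 1 else 0)|
      ≤ ν p * ∑ x ∈ Δ, dind (Λ := Λ) p x := by
    intro p
    rw [← mul_sub, abs_mul, abs_of_nonneg (hν0 p)]
    refine mul_le_mul_of_nonneg_left ?_ (hν0 p)
    by_cases hA : ∀ x ∈ Δ, ∀ hx : x ∈ Λ, p.1 ⟨x, hx⟩ = p.2 ⟨x, hx⟩
    · have heq : (glueWith Λ p.1 τ ∈ E) = (glueWith Λ p.2 τ' ∈ E) := by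
        refine hdep fun x hx => ?_
        have hxΔ : x ∈ Δ := Finset.mem_coe.1 hx
        have hxΛ : x ∈ Λ := hΔ hxΔ
        rw [glueWith_apply_mem Λ p.1 τ hxΛ, glueWith_apply_mem Λ p.2 τ' hxΛ]
        exact hA x hxΔ hxΛ
      simp only [heq, sub_self, abs_zero]
      exact Finset.sum_nonneg fun x _ => dind_nonneg p x
    · push Not at hA
      obtain ⟨x, hxΔ, hxΛ, hne⟩ := hA
      calc |(if glueWith Λ p.1 τ ∈ E then (1 : ℝ) else 0) - (if glueWith Λ p.2 τ' ∈ E then 1 else 0)| ≤ 1 := by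
            split_ifs <;> norm_num
        _ = dind (Λ := Λ) p x := (dind_eq_one_of_ne p hxΛ hne).symm
        _ ≤ ∑ x ∈ Δ, dind (Λ := Λ) p x := Finset.single_le_sum (fun x _ => dind_nonneg p x) hxΔ
  refine (Finset.abs_sum_le_sum_abs _ _).trans ((Finset.sum_le_sum fun p _ => h3 p).trans ?_)
  unfold dis
  rw [Finset.sum_comm]
  refine le_of_eq (Finset.sum_congr rfl fun x _ => ?_)
  rw [Finset.mul_sum]

omit [MeasurableSpace S] [MeasurableSingletonClass S] [Nonempty S] in
/-- `Σ_{x ∈ Δ} ρ(x) ≤ e^{−m d(Δ,y)} Φ(ν)` for `Δ ⊆ Λ`. [folklore] -/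
private theorem sum_dis_le_exp_mul_phi {m : ℝ} (hm : 0 ≤ m) (y : Site d) {ν : (↥Λ → S) × (↥Λ → S) → ℝ}
    (hν : ∀ p, 0 ≤ ν p) {Δ : Finset (Site d)} (hΔ : Δ ⊆ Λ) :
    ∑ x ∈ Δ, dis Λ ν x ≤ Real.exp (-(m * finsetSupDist Δ {y})) * phi (Λ := Λ) m y ν := by
  have hdis0 : ∀ x, 0 ≤ dis Λ ν x := dis_nonneg hν
  have h1 : ∀ x ∈ Δ, dis Λ ν x ≤ Real.exp (-(m * finsetSupDist Δ {y})) * (dis Λ ν x * wgt m y x) := by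
    intro x hx
    have hd : (finsetSupDist Δ {y} : ℝ) ≤ supDist x y := by
      exact_mod_cast finsetSupDist_le hx (Finset.mem_singleton_self y)
    have h2 : 1 ≤ Real.exp (-(m * finsetSupDist Δ {y})) * wgt m y x := by
      unfold wgt
      rw [← Real.exp_add]
      exact Real.one_le_exp (by nlinarith)
    calc dis Λ ν x = dis Λ ν x * 1 := (mul_one _).symm
      _ ≤ dis Λ ν x * (Real.exp (-(m * finsetSupDist Δ {y})) * wgt m y x) := mul_le_mul_of_nonneg_left h2 (hdis0 x)
      _ = _ := by ring
  calc ∑ x ∈ Δ, dis Λ ν x ≤ ∑ x ∈ Δ, Real.exp (-(m * finsetSupDist Δ {y})) * (dis Λ ν x * wgt m y x) :=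
        Finset.sum_le_sum h1
    _ = Real.exp (-(m * finsetSupDist Δ {y})) * ∑ x ∈ Δ, dis Λ ν x * wgt m y x := by rw [Finset.mul_sum]
    _ ≤ Real.exp (-(m * finsetSupDist Δ {y})) * phi (Λ := Λ) m y ν := by
        refine mul_le_mul_of_nonneg_left ?_ (Real.exp_pos _).le
        exact Finset.sum_le_sum_of_subset_of_nonneg hΔ fun x _ _ => mul_nonneg (hdis0 x) (wgt_pos m y x).le

/-- **From a one-block finite-size condition to exponential decay of a boundary perturbation** (the
coupling rendering of [MOS94] Thm 1.1 / [MO1] Thm 4.1 + Prop 4.1, abstract form).  Let `Λ` be a finite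
volume, `τ = τ′` off a site `y`, `(B_i, π_i)` a probability distribution on blocks `B_i ⊆ Λ` of cardinality
`≤ V` whose outer `r`-boundary sites are within `D` of the block, such that (INPUT) on every block the two
conditional laws give far-set events (`> g` away from the disagreement sites of the boundary conditions)
probabilities within `ε · #(disagreement sites)`, and (COVERING) `A · π{i : z ∈ ∂_r^+B_i} + κ ≤ π{i : z ∈ B_i}`
for all `z ∈ Λ` with `A = (2g+1)^d e^{mg} + ε V e^{mD}`, `0 < κ ≤ 1`, `m ≥ 0`.  Then for every event `E` of
the spins in `Δ ⊆ Λ`,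
`|μ_Λ^τ(E) − μ_Λ^{τ′}(E)| ≤ (A · π{i : y ∈ ∂_r^+B_i} / κ) · e^{−m d(Δ, y)}`.
[cite: MartinelliOlivieriSchonmann1994, Theorem 1.1 (proof, p0006 L25–34)] -/
theorem abs_sub_le_of_blockFamily {y : Site d} (hττ' : ∀ z, z ≠ y → τ z = τ' z) (hBΛ : ∀ i, B i ⊆ Λ)
    (hπ : ∀ i, 0 ≤ π i) (hπ1 : ∑ i, π i = 1) {ε : ℝ} (hε : 0 ≤ ε)
    (hIN : ∀ i (ζ₁ ζ₂ : ↥Λ → S) (E : Set (Site d → S)), MeasurableSet E →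
      DependsOn (· ∈ E) {x | x ∈ B i ∧ ∀ z ∈ rOuterBoundary r (B i),
        glueWith Λ ζ₁ τ z ≠ glueWith Λ ζ₂ τ' z → g < supDist x z} →
      |(U.spec β (B i) (glueWith Λ ζ₁ τ)).real E - (U.spec β (B i) (glueWith Λ ζ₂ τ')).real E| ≤
        ε * ((rOuterBoundary r (B i)).filter (fun z => glueWith Λ ζ₁ τ z ≠ glueWith Λ ζ₂ τ' z)).card)
    {m : ℝ} (hm : 0 ≤ m) {V Dm : ℕ} (hV : ∀ i, (B i).card ≤ V)
    (hDm : ∀ i, ∀ z ∈ rOuterBoundary r (B i), ∀ x ∈ B i, supDist x z ≤ Dm)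
    {κ : ℝ} (hκ0 : 0 < κ) (hκ1 : κ ≤ 1)
    (hG2 : ∀ z ∈ Λ, Acst d g m ε V Dm * bdP (r := r) (B := B) (π := π) z + κ ≤ covP (B := B) (π := π) z)
    {Δ : Finset (Site d)} (hΔ : Δ ⊆ Λ) {E : Set (Site d → S)} (hE : MeasurableSet E)
    (hdep : DependsOn (· ∈ E) (↑Δ : Set (Site d))) :
    |(U.spec β Λ τ).real E - (U.spec β Λ τ').real E| ≤
      Acst d g m ε V Dm * bdP (r := r) (B := B) (π := π) y / κ * Real.exp (-(m * finsetSupDist Δ {y})) := by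
  -- the input in `tvd` form
  have hIN' : ∀ i (p : (↥Λ → S) × (↥Λ → S)),
      tvd (qM U β τ (B i) (far (r := r) τ τ' g (B i) p) p.1) (qM U β τ' (B i) (far (r := r) τ τ' g (B i) p) p.2) ≤
        ε * (disB (r := r) τ τ' (B i) p).card := by
    intro i p
    obtain ⟨E', hE'm, hE'd, htv⟩ := tvd_qM_eq U β (Λ := Λ) (far_subset τ τ' g (B i) p) τ τ' p.1 p.2
    rw [htv]
    refine (le_abs_self _).trans (hIN i p.1 p.2 E' hE'm ?_)
    refine fun σ σ' h => hE'd fun x hx => h x ?_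
    have hx' := Finset.mem_filter.1 (Finset.mem_coe.1 hx)
    exact ⟨hx'.1, fun z hz hne => hx'.2 z (Finset.mem_filter.2 ⟨hz, hne⟩)⟩
  set A := Acst d g m ε V Dm with hA
  set Φ₀ := phi (Λ := Λ) m y (chain U β Λ τ τ' B π g 0) with hΦ₀
  set C := A * bdP (r := r) (B := B) (π := π) y / κ with hC
  set e := Real.exp (-(m * finsetSupDist Δ {y})) with he
  have hbound : ∀ t : ℕ, |(U.spec β Λ τ).real E - (U.spec β Λ τ').real E| ≤ e * ((1 - κ) ^ t * Φ₀ + C) := by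
    intro t
    calc |(U.spec β Λ τ).real E - (U.spec β Λ τ').real E|
        ≤ ∑ x ∈ Δ, dis Λ (chain U β Λ τ τ' B π g t) x := abs_sub_le_sum_dis U β τ τ' g hBΛ hπ hπ1 t hΔ hE hdep
      _ ≤ e * phi (Λ := Λ) m y (chain U β Λ τ τ' B π g t) :=
          sum_dis_le_exp_mul_phi hm y (chain_nonneg U β τ τ' g hπ t) hΔ
      _ ≤ e * ((1 - κ) ^ t * Φ₀ + C) :=
          mul_le_mul_of_nonneg_left (phi_chain_le U β τ τ' g hττ' hBΛ hπ hπ1 hε hIN' hm hV hDm hκ0 hκ1 hG2 t)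
            (Real.exp_pos _).le
  -- let `t → ∞`
  have hlim : Tendsto (fun t : ℕ => e * ((1 - κ) ^ t * Φ₀ + C)) atTop (nhds (e * (0 * Φ₀ + C))) := by
    have h1 : Tendsto (fun t : ℕ => (1 - κ) ^ t) atTop (nhds 0) :=
      tendsto_pow_atTop_nhds_zero_of_lt_one (by linarith) (by linarith)
    exact ((h1.mul_const Φ₀).add_const C).const_mul e
  have hfin := le_of_tendsto_of_tendsto' tendsto_const_nhds hlim hbound
  calc |(U.spec β Λ τ).real E - (U.spec β Λ τ').real E| ≤ e * (0 * Φ₀ + C) := hfin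
    _ = C * e := by ring

end Chain

end BlockCoupling

end Literature.Probability.LatticeModels
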